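import Summits.AtomisticToContinuum.Crystallization.Theorems.ChargedEnergyGapHcpForceFree
import Summits.AtomisticToContinuum.Crystallization.Theorems.ExcessDecayLiouvilleFarField
import HarnessLib

/-!
# Charged energy gap — lens-3 g62, part P-V: KERNEL TAIL BOUNDS for the excision functional (the analytic input of the charging lemma)

Cell `decomp-a2c`, seat lens-3, generation 62, part P-V (after P-U).  ELEMENTARY·PROVED.  P-P typed the (R2) excision functional
`E_X(y) = Σ'_{z ∈ P ∩ X, z ≠ y} (V′(d_yz))⁺·d_yz` and proved `q^X_y(W_{r₀,v}) ≥ −(‖r₀‖‖v‖)²·E_X(y)`; its docstring left the CHARGING LEMMA with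
the float constants `S = sup_z Σ_{d<60} (V′)⁺d ≈ 1.3` and «far pairs ≤ 2·10⁻⁸».  This file replaces both floats by KERNEL constants, uniformly over
every `s`-separated reference and every excised set, from the tree's dyadic-shell bound `ExcessDecayLiouville.tsum_inv_pow_le_of_separated`
(`Σ'_{a ∈ P, R ≤ |a − y|} |a − y|⁻⁶ ≤ 1024/(s³R³)` for `s ≤ R`):
* `excisionSum_inter_far` — bonds of length `≤ 1` are free: `E_X(y) = E_{X ∩ {1 < d}}(y)`;
* ★★ `excisionSum_le_far` — if every excised point farther than `1` from `y` is at distance `≥ R` (`1 ≤ R`, `s ≤ R`), `E_X(y) ≤ 1024/(s³R³)`;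
* ★★ `excisionSum_le_uniform` — `E_X(y) ≤ 1024/s³` for EVERY `X` (`0 < s ≤ 1`);
* `excisionMassL_le_uniform`, ★ `modelFarL_rotField_ge_uniform` — the weighted forms: every rotation instance's localised model is
  `≥ −λ·(‖r₀‖‖v‖)²·(1024/s³)·Σ_{motif ∖ X} χ·w`;
* `record_excision_tails` — at the record dials (`s = 3/5`, `λ = 1/2`, `τ = 3/100`, near radius `3ϱ/8 = 60`): `1024/s³ = 128000/27`, the strain-
  prefactored near charge per site `(1/2)·(τ²/4)·128000/27 = 8/15 < 1` (so `C_H = 1` pays the near part — `C_H` is EXISTENTIAL in (H𝄪ˢ)), and the far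
  residue per site `(1/2)·(τ²/4)·1024/(s³·60³) = 1/405000 < 3·10⁻⁶`.
What remains of the charging lemma (g63 (a)) is now purely combinatorial: the motif/points periodic refolding of the pair sum and the assignment of
near pairs to PRICED excised sites (`pricedNearCountL`) and of the far residue to the shell / transition masses.
-/

noncomputable section

open scoped Classical

open Literature.MathematicalPhysics.StatisticalMechanics Literature.Geometry.DiscreteGeometry
open Summit.AtomisticToContinuum.Crystallization.Theses.PricedLinkCensus
open Summit.AtomisticToContinuum.Crystallization.Theorems.ChargedEnergyGapNegative

namespace Summit.AtomisticToContinuum.Crystallization.Theorems.ChargedEnergyGapChartDial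

section ExcisionTails

variable (P : PeriodicConfiguration 3) (X : Set E3) (y : E3)

/-- `(V′(d))⁺ = 0` for `d ≤ 1` and `V′(1) = 0`: bonds of length `≤ 1` never enter the excision functional. -/
theorem max_ljD1_eq_zero {t : ℝ} (ht : 0 < t) (ht1 : t ≤ 1) : max (ljD1 t) 0 = 0 :=
  max_eq_right (ljD1_nonpos ht ht1)

/-- `(V′(d))⁺·d ≤ d⁻⁶` for `d ≥ 1` (`V′(d) = −d⁻¹³ + d⁻⁷ ≤ d⁻⁷`). -/
theorem max_ljD1_mul_le {t : ℝ} (ht1 : 1 ≤ t) : max (ljD1 t) 0 * t ≤ (t⁻¹) ^ (3 + 3) := by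
  have ht : 0 < t := by linarith
  have hmax : max (ljD1 t) 0 ≤ (t⁻¹) ^ 7 :=
    max_le (by unfold ljD1; linarith [show (0 : ℝ) ≤ (t⁻¹) ^ 13 by positivity]) (by positivity)
  calc max (ljD1 t) 0 * t ≤ (t⁻¹) ^ 7 * t := mul_le_mul_of_nonneg_right hmax ht.le
    _ = (t⁻¹) ^ (3 + 3) * (t⁻¹ * t) := by ring
    _ = (t⁻¹) ^ (3 + 3) := by rw [inv_mul_cancel₀ ht.ne', mul_one]

/-- ★ Bonds of length `≤ 1` are FREE: the excision functional only sees the excised points farther than `1`. -/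
theorem excisionSum_inter_far : excisionSum P X y = excisionSum P (X ∩ {z | 1 < dist y z}) y := by
  unfold excisionSum
  refine tsum_congr fun z => ?_
  have hd : 0 < dist y (z : E3) := dist_pos.2 (fun h => z.2.2 h.symm)
  by_cases hz : (z : E3) ∈ X
  · by_cases h1 : 1 < dist y (z : E3)
    · have : (z : E3) ∈ X ∩ {z | 1 < dist y z} := ⟨hz, h1⟩
      rw [if_pos hz, if_pos this]
    · have : (z : E3) ∉ X ∩ {z | 1 < dist y z} := fun h => h1 h.2
      rw [if_pos hz, if_neg this, max_ljD1_eq_zero hd (not_lt.1 h1), zero_mul]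
  · have : (z : E3) ∉ X ∩ {z | 1 < dist y z} := fun h => hz h.1
    rw [if_neg hz, if_neg this]

/-- Pointwise: if every excised point is at distance `≥ R ≥ 1` from `y`, the excision summand is dominated by the indicator of `{R ≤ d}` times
`d⁻⁶`. -/
theorem excisionSummand_le_far {R : ℝ} (hR : 1 ≤ R) (hX : ∀ z ∈ P.points, z ∈ X → z ≠ y → R ≤ dist y z)
    (z : {z : E3 // z ∈ P.points ∧ z ≠ y}) :
    (if (z : E3) ∈ X then max (ljD1 (dist y z)) 0 * dist y (z : E3) else 0) ≤
      (if R ≤ dist (z : E3) y then (dist (z : E3) y)⁻¹ ^ (3 + 3) else 0) := by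
  rw [dist_comm (z : E3) y]
  by_cases hz : (z : E3) ∈ X
  · have hRz : R ≤ dist y (z : E3) := hX z z.2.1 hz z.2.2
    rw [if_pos hz, if_pos hRz]
    exact max_ljD1_mul_le (hR.trans hRz)
  · rw [if_neg hz]
    split_ifs <;> positivity

/-- ★★ **FAR TAIL BOUND.**  For an `s`-separated reference, if every excised point farther than `1` from `y` is at distance `≥ R` (`1 ≤ R`,
`s ≤ R`), then `E_X(y) ≤ 1024/(s³·R³)` — the tree's dyadic-shell packing bound `ExcessDecayLiouville.tsum_inv_pow_le_of_separated`. -/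
theorem excisionSum_le_far {s : ℝ} (hP : IsSeparatedRef s P) (hs : 0 < s) {R : ℝ} (hsR : s ≤ R) (hR : 1 ≤ R)
    (hX : ∀ z ∈ P.points, z ∈ X → z ≠ y → 1 < dist y z → R ≤ dist y z) : excisionSum P X y ≤ 1024 / (s ^ 3 * R ^ 3) := by
  rw [excisionSum_inter_far]
  set X' : Set E3 := X ∩ {z | 1 < dist y z} with hX'def
  have hX' : ∀ z ∈ P.points, z ∈ X' → z ≠ y → R ≤ dist y z := fun z hz hzX hzy => hX z hz hzX.1 hzy hzX.2
  have hsep : ∀ a ∈ P.points, ∀ b ∈ P.points, a ≠ b → s ≤ dist a b := hP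
  have hT := ExcessDecayLiouville.tsum_inv_pow_le_of_separated (X := P.points) y (k := 3) (by norm_num) hs hsR hsep
  have hTs := ExcessDecayLiouville.summable_inv_pow_of_separated (X := P.points) y (k := 3) (by norm_num) hs hsR hsep
  have hind : Set.indicator {z : E3 | z ∈ P.points ∧ z ≠ y} (fun z : E3 => if R ≤ dist z y then (dist z y)⁻¹ ^ (3 + 3) else (0 : ℝ)) =
      Set.indicator {a : E3 | a ∈ P.points ∧ R ≤ dist a y} (fun a : E3 => (dist a y)⁻¹ ^ (3 + 3)) := by
    funext x
    simp only [Set.indicator_apply, Set.mem_setOf_eq]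
    by_cases hx : x ∈ P.points
    · by_cases hRx : R ≤ dist x y
      · have hxy : x ≠ y := by
          rintro rfl
          rw [dist_self] at hRx
          linarith
        simp [hx, hxy, hRx]
      · by_cases hxy : x = y <;> simp [hx, hxy, hRx]
    · simp [hx]
  have hsumS : Summable fun z : {z : E3 // z ∈ P.points ∧ z ≠ y} =>
      (if R ≤ dist (z : E3) y then (dist (z : E3) y)⁻¹ ^ (3 + 3) else (0 : ℝ)) := by
    have h1 := (summable_subtype_iff_indicator (s := {a : E3 | a ∈ P.points ∧ R ≤ dist a y})
      (f := fun a : E3 => (dist a y)⁻¹ ^ (3 + 3))).1 hTs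
    rw [← hind] at h1
    exact (summable_subtype_iff_indicator (s := {z : E3 | z ∈ P.points ∧ z ≠ y})
      (f := fun z : E3 => if R ≤ dist z y then (dist z y)⁻¹ ^ (3 + 3) else (0 : ℝ))).2 h1
  calc excisionSum P X' y
      ≤ ∑' z : {z : E3 // z ∈ P.points ∧ z ≠ y}, (if R ≤ dist (z : E3) y then (dist (z : E3) y)⁻¹ ^ (3 + 3) else (0 : ℝ)) :=
        Summable.tsum_le_tsum (excisionSummand_le_far P X' y hR hX') (summable_excisionSummand P X' y) hsumS
    _ = ∑' x : E3, Set.indicator {z : E3 | z ∈ P.points ∧ z ≠ y}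
          (fun z : E3 => if R ≤ dist z y then (dist z y)⁻¹ ^ (3 + 3) else (0 : ℝ)) x :=
        tsum_subtype {z : E3 | z ∈ P.points ∧ z ≠ y} (fun z : E3 => if R ≤ dist z y then (dist z y)⁻¹ ^ (3 + 3) else (0 : ℝ))
    _ = ∑' x : E3, Set.indicator {a : E3 | a ∈ P.points ∧ R ≤ dist a y} (fun a : E3 => (dist a y)⁻¹ ^ (3 + 3)) x := by rw [hind]
    _ = ∑' a : {a : E3 // a ∈ P.points ∧ R ≤ dist a y}, (dist (a : E3) y)⁻¹ ^ (3 + 3) :=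
        (tsum_subtype {a : E3 | a ∈ P.points ∧ R ≤ dist a y} (fun a : E3 => (dist a y)⁻¹ ^ (3 + 3))).symm
    _ ≤ 1024 / (s ^ 3 * R ^ 3) := hT

/-- ★★ **UNIFORM BOUND.**  For an `s`-separated reference with `0 < s ≤ 1`: `E_X(y) ≤ 1024/s³` for EVERY excised set `X` and every `y`. -/
theorem excisionSum_le_uniform {s : ℝ} (hP : IsSeparatedRef s P) (hs : 0 < s) (hs1 : s ≤ 1) : excisionSum P X y ≤ 1024 / s ^ 3 := by
  have h := excisionSum_le_far P X y hP hs hs1 le_rfl (fun z _ _ _ h1 => h1.le)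
  simpa using h

/-- The far tail with every excised point at distance `≥ R` (no condition on short bonds needed). -/
theorem excisionSum_le_farAll {s : ℝ} (hP : IsSeparatedRef s P) (hs : 0 < s) {R : ℝ} (hsR : s ≤ R) (hR : 1 ≤ R)
    (hX : ∀ z ∈ P.points, z ∈ X → z ≠ y → R ≤ dist y z) : excisionSum P X y ≤ 1024 / (s ^ 3 * R ^ 3) :=
  excisionSum_le_far P X y hP hs hsR hR (fun z hz hzX hzy _ => hX z hz hzX hzy)

end ExcisionTails

section ExcisionTailsWeighted

variable (ϱχ : ℝ) {m : ℕ} (D : Fin m → Set E3) (σ : Fin m → Bool) (P : PeriodicConfiguration 3) (X : Set E3) (ϱ : ℝ) (C : Set E3)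

/-- ★ The weighted form: `excisionMassL ≤ (1024/s³)·Σ_{y ∈ motif ∖ X} χ_σ(y)·w_C(y)`. -/
theorem excisionMassL_le_uniform {s : ℝ} (hP : IsSeparatedRef s P) (hs : 0 < s) (hs1 : s ≤ 1) :
    excisionMassL ϱχ D σ P X ϱ C ≤
      1024 / s ^ 3 * ∑ y ∈ P.motif, (if y ∈ X then 0 else localFactor ϱχ D σ y * profileWeight ϱ C y) := by
  unfold excisionMassL
  rw [Finset.mul_sum]
  refine Finset.sum_le_sum fun y _ => ?_
  split_ifs
  · simp
  · have hχ := localFactor_nonneg (ϱχ := ϱχ) (D := D) (σ := σ) y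
    have hw := profileWeight_nonneg ϱ C y
    have hE := excisionSum_le_uniform P X y hP hs hs1
    calc localFactor ϱχ D σ y * (profileWeight ϱ C y * excisionSum P X y)
        = (localFactor ϱχ D σ y * profileWeight ϱ C y) * excisionSum P X y := by ring
      _ ≤ (localFactor ϱχ D σ y * profileWeight ϱ C y) * (1024 / s ^ 3) := mul_le_mul_of_nonneg_left hE (mul_nonneg hχ hw)
      _ = 1024 / s ^ 3 * (localFactor ϱχ D σ y * profileWeight ϱ C y) := by ring

variable {P}

/-- ★ … hence EVERY rotation instance's localised model is bounded below by the strain-squared prefactor times a kernel constant times the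
weighted non-excised mass: `modelFarL(W_{r₀,v}) ≥ −λ·(‖r₀‖‖v‖)²·(1024/s³)·Σ_{motif ∖ X} χ·w` (P-P `modelFarL_rotField_ge` + the uniform bound). -/
theorem modelFarL_rotField_ge_uniform (hS : IsSiteStressFree P) {s : ℝ} (hP : IsSeparatedRef s P) (hs : 0 < s) (hs1 : s ≤ 1)
    {lamQ : ℝ} (hlam : 0 ≤ lamQ) (r₀ v : E3) :
    -(lamQ * (‖r₀‖ * ‖v‖) ^ 2 *
        (1024 / s ^ 3 * ∑ y ∈ P.motif, (if y ∈ X then 0 else localFactor ϱχ D σ y * profileWeight ϱ C y))) ≤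
      modelFarL ϱχ D σ (rotField r₀ v) P X lamQ ϱ C := by
  have h1 := modelFarL_rotField_ge ϱχ D σ X ϱ C hS hlam r₀ v
  have h2 := excisionMassL_le_uniform ϱχ D σ P X ϱ C hP hs hs1
  have h3 : 0 ≤ lamQ * (‖r₀‖ * ‖v‖) ^ 2 := by positivity
  nlinarith [mul_le_mul_of_nonneg_left h2 h3]

/-- RECORD NUMERALS (`s = 3/5`, `λ = 1/2`, `τ = 3/100` so `(‖r₀‖‖v‖)² ≤ τ²/4`, near radius `3ϱ/8 = 60`): the uniform constant `1024/s³ = 128000/27`,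
the strain-prefactored near charge per site `8/15 < 1` (so `C_H = 1` pays it), the far constant `1024/(s³·60³) = 16/729` and the prefactored far
residue per site `1/405000 < 3·10⁻⁶`. -/
theorem record_excision_tails :
    (1024 : ℝ) / (3 / 5) ^ 3 = 128000 / 27 ∧ (1 / 2 : ℝ) * ((3 / 100) ^ 2 / 4) * (128000 / 27) = 8 / 15 ∧ (8 / 15 : ℝ) < 1 ∧
      (1024 : ℝ) / ((3 / 5) ^ 3 * 60 ^ 3) = 16 / 729 ∧ (1 / 2 : ℝ) * ((3 / 100) ^ 2 / 4) * (16 / 729) = 1 / 405000 ∧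
      (1 / 405000 : ℝ) < 3 / 1000000 := by
  norm_num

end ExcisionTailsWeighted

end Summit.AtomisticToContinuum.Crystallization.Theorems.ChargedEnergyGapChartDial
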